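import Summits.CriticalPhenomena.Ising3D.IsingColumnFaceL11CensusSigmaCellTrg
import Summits.CriticalPhenomena.Ising3D.ExclusionSentencesTrgGammaRefine

/-!
# The σ-cell's full `TRG` catalogue members as kernel facts, part 2 of 2 (cell `pub-ising3x`, seat
recog-1; paper §7.3 «12 trigonometric members»)

HONEST FRAMING: lottery ticket; floor = tightest certified 3D Ising CFT bounds; no exact-solution
claim without a proof. Island framing: certified exclusion region at stated derivative order and
assumptions; not a determination of the 3D Ising critical exponents beyond that.
HONEST SCOPE: a statement about the frozen catalogue's members inside `σcell = [33957/65536, 16979/32768]`,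
NOT about `Δσ`; Theorem 1's region has no σ-face, no bridge is instantiated (the σ-cell is the campaign's input
cell).

Parts 4–7 of the eight-part kernel decision for the whole frozen `TRG` table on the decimal superset
window `σW ⊇ σcell` (see part 1, `IsingColumnFaceL11CensusSigmaCellTrg.lean`), the assembled sentence
`trgFullExcluded_σW`, and the σ-cell statements:
* COMPLETENESS `trgFull_listed_of_mem_σcell` — every member of `trgFullFamily 17 32` (all 6 432
  monomials, `h ≤ 32`, `Γ(¼)` / `Γ(⅓)` powers included) in the σ-cell is the value of one of the twelve
  tuples `σcellTrgGEx`;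
* MEMBERSHIP `σcellTrgGEx_mem_σcell` (each listed value lies in the σ-cell, by its certified enclosure
  `trgGTupleEncl` over the tree's constants incl. `gammaQuarterI`, `gammaThirdI` of
  `ExclusionSentencesGamma`), `σcellTrgGEx_mem_trgFullFamily` (each tuple satisfies the family's side
  conditions) — so the list is exact — and `σcellTrgGEx_nodup_values` (pairwise disjoint enclosures ⇒
  twelve distinct values) ⇒ **`σcell_trg_ncard`: exactly 12 distinct `TRG` values in the σ-cell**.
§7.3's «simplest (2/5)√2·G» is the listed tuple `(2, 5, 1, 0, 0, 0, 4, 1)` (also the only member of the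
`Γ`-free sub-table, `trg_eq_of_mem_σcell`). Not a statement about `Δσ`; no certificate, datum or axiom of
the σ–ε system is used. [folklore]
lottery ticket; floor = tightest certified 3D Ising CFT bounds; no exact-solution claim without a proof.
-/

namespace Summit.CriticalPhenomena.Ising3D
namespace ColumnFaceL11
open Set Literature.MathematicalPhysics.QuantumFieldTheory.ConformalBootstrap3D

/-! ### Parts 4–7 and the assembled sentence -/

/-- Part 4 of 8 of the full-`TRG` sentence on `σW` (one `decide +kernel`). [folklore] -/
theorem trgFullPart_σW_p4 : trgFullPart 17 32 4 σWlo σWhi σcellTrgGEx = true := by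
  decide +kernel

/-- Part 5 of 8 of the full-`TRG` sentence on `σW`. [folklore] -/
theorem trgFullPart_σW_p5 : trgFullPart 17 32 5 σWlo σWhi σcellTrgGEx = true := by
  decide +kernel

/-- Part 6 of 8 of the full-`TRG` sentence on `σW`. [folklore] -/
theorem trgFullPart_σW_p6 : trgFullPart 17 32 6 σWlo σWhi σcellTrgGEx = true := by
  decide +kernel

/-- Part 7 of 8 of the full-`TRG` sentence on `σW`. [folklore] -/
theorem trgFullPart_σW_p7 : trgFullPart 17 32 7 σWlo σWhi σcellTrgGEx = true := by
  decide +kernel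

/-- The full-`TRG` sentence (`D ≤ 17`, `h ≤ 32`, whole table) on `σW`, assembled from the eight parts:
the twelve tuples are the COMPLETE member list. [folklore] -/
theorem trgFullExcluded_σW : trgFullExcluded 17 32 σWlo σWhi σcellTrgGEx = true :=
  trgFullExcluded_of_parts trgFullPart_σW_p0 trgFullPart_σW_p1 trgFullPart_σW_p2 trgFullPart_σW_p3
    trgFullPart_σW_p4 trgFullPart_σW_p5 trgFullPart_σW_p6 trgFullPart_σW_p7

/-- **Completeness on the σ-cell, whole `TRG` table.** Every member of `trgFullFamily 17 32` in the
σ-cell is the value of one of the twelve listed tuples. [folklore] -/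
theorem trgFull_listed_of_mem_σcell {x : ℝ} (hx : x ∈ σcell) (hm : x ∈ trgFullFamily 17 32) :
    ∃ e ∈ σcellTrgGEx, x = trgGTupleVal e :=
  trgFullExcluded_sound trgFullExcluded_σW (mem_σW_of_mem_σcell hx) hm

/-! ### The listed `TRG` values lie in the σ-cell, belong to the family, and are pairwise distinct -/

/-- Every tuple of `ex` has a certified value enclosure INSIDE `[a, b]`. [folklore] -/
def trgGTuplesInside (a b : ℚ) (ex : List (ℕ × ℕ × ℕ × ℤ × ℕ × ℤ × ℕ × ℤ)) : Bool :=
  ex.all fun e => decide (a ≤ (trgGTupleEncl e).1) && decide ((trgGTupleEncl e).2 ≤ b)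

/-- Soundness of `trgGTuplesInside`: each listed value lies in `[a, b]`. [folklore] -/
theorem trgGTuplesInside_sound {a b : ℚ} {ex : List (ℕ × ℕ × ℕ × ℤ × ℕ × ℤ × ℕ × ℤ)}
    (h : trgGTuplesInside a b ex = true) {e : ℕ × ℕ × ℕ × ℤ × ℕ × ℤ × ℕ × ℤ} (he : e ∈ ex) :
    (a : ℝ) ≤ trgGTupleVal e ∧ trgGTupleVal e ≤ b := by
  unfold trgGTuplesInside at h
  have h1 := List.all_eq_true.mp h e he
  simp only [Bool.and_eq_true, decide_eq_true_eq] at h1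
  obtain ⟨h2, h3⟩ := h1
  obtain ⟨hv1, hv2⟩ := trgGTupleVal_mem_encl e
  exact ⟨(Rat.cast_le.mpr h2).trans hv1, hv2.trans (Rat.cast_le.mpr h3)⟩

/-- The twelve enclosures lie inside the σ-cell's end points (milliseconds). [folklore] -/
theorem trgGTuplesInside_σcell : trgGTuplesInside (33957 / 65536) (16979 / 32768) σcellTrgGEx = true := by
  decide +kernel

/-- **Each listed `TRG` value lies in the σ-cell.** [folklore] -/
theorem σcellTrgGEx_mem_σcell {e : ℕ × ℕ × ℕ × ℤ × ℕ × ℤ × ℕ × ℤ} (he : e ∈ σcellTrgGEx) :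
    trgGTupleVal e ∈ σcell := by
  obtain ⟨h1, h2⟩ := trgGTuplesInside_sound trgGTuplesInside_σcell he
  simp only [σcell, mem_Icc]
  push_cast at h1 h2
  exact ⟨h1, h2⟩

/-- Decidable side conditions of `trgFullFamily D h` for a tuple `(p, q, u, a, g, b, L, s)`. [folklore] -/
def trgGTupleOK (D h : ℕ) (e : ℕ × ℕ × ℕ × ℤ × ℕ × ℤ × ℕ × ℤ) : Bool :=
  match e with
  | (p, q, u, a, g, b, L, s) =>
    decide (1 ≤ p) && decide (p ≤ h) && decide (1 ≤ q) && decide (q ≤ h) && decide (u ≤ 2) &&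
      decide (L ≤ 4) && decide (g ≤ 1) && decide (-6 ≤ a) && decide (a ≤ 6) &&
      decide (-(4 - (g : ℤ)) ≤ b) && decide (b ≤ 4 - (g : ℤ)) && decide (-1 ≤ s) && decide (s ≤ 1) &&
      decide (a ≠ 0 ∨ b ≠ 0 ∨ s ≠ 0) &&
      decide (a.natAbs + 2 * b.natAbs + 2 * s.natAbs + (if u = 0 then 0 else 1) ≤ D)

/-- Soundness of `trgGTupleOK`: the tuple's value is a member of `trgFullFamily D h`. [folklore] -/
theorem mem_trgFullFamily_of_trgGTupleOK {D h : ℕ} {e : ℕ × ℕ × ℕ × ℤ × ℕ × ℤ × ℕ × ℤ}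
    (hok : trgGTupleOK D h e = true) : trgGTupleVal e ∈ trgFullFamily D h := by
  obtain ⟨p, q, u, a, g, b, L, s⟩ := e
  simp only [trgGTupleOK, Bool.and_eq_true, decide_eq_true_eq] at hok
  obtain ⟨⟨⟨⟨⟨⟨⟨⟨⟨⟨⟨⟨⟨⟨hp1, hph⟩, hq1⟩, hqh⟩, hu⟩, hL⟩, hg⟩, ha1⟩, ha2⟩, hb1⟩, hb2⟩, hs1⟩, hs2⟩,
    hne⟩, hD⟩ := hok
  exact ⟨p, q, u, L, g, a, b, s, hp1, hph, hq1, hqh, hu, hL, hg, ha1, ha2, hb1, hb2, hs1, hs2, hne, hD,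
    rfl⟩

/-- The twelve listed tuples satisfy the side conditions of `trgFullFamily 17 32`. [folklore] -/
theorem trgGTupleOK_σcellTrgGEx : σcellTrgGEx.all (trgGTupleOK 17 32) = true := by
  decide +kernel

/-- **Each listed `TRG` tuple is a member of the frozen table**, so with completeness the list is exact.
[folklore] -/
theorem σcellTrgGEx_mem_trgFullFamily {e : ℕ × ℕ × ℕ × ℤ × ℕ × ℤ × ℕ × ℤ} (he : e ∈ σcellTrgGEx) :
    trgGTupleVal e ∈ trgFullFamily 17 32 :=
  mem_trgFullFamily_of_trgGTupleOK (List.all_eq_true.mp trgGTupleOK_σcellTrgGEx e he)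

/-- Separation test for two tuples: their certified enclosures are DISJOINT. [folklore] -/
def trgGSep (e f : ℕ × ℕ × ℕ × ℤ × ℕ × ℤ × ℕ × ℤ) : Bool :=
  decide ((trgGTupleEncl e).2 < (trgGTupleEncl f).1) || decide ((trgGTupleEncl f).2 < (trgGTupleEncl e).1)

/-- Separated tuples have different values. [folklore] -/
theorem trgGTupleVal_ne_of_trgGSep {e f : ℕ × ℕ × ℕ × ℤ × ℕ × ℤ × ℕ × ℤ} (h : trgGSep e f = true) :
    trgGTupleVal e ≠ trgGTupleVal f := by
  simp only [trgGSep, Bool.or_eq_true, decide_eq_true_eq] at h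
  obtain ⟨he1, he2⟩ := trgGTupleVal_mem_encl e
  obtain ⟨hf1, hf2⟩ := trgGTupleVal_mem_encl f
  rcases h with hd | hd
  · have hd' : (((trgGTupleEncl e).2 : ℚ) : ℝ) < (((trgGTupleEncl f).1 : ℚ) : ℝ) := Rat.cast_lt.mpr hd
    exact ne_of_lt (lt_of_le_of_lt he2 (lt_of_lt_of_le hd' hf1))
  · have hd' : (((trgGTupleEncl f).2 : ℚ) : ℝ) < (((trgGTupleEncl e).1 : ℚ) : ℝ) := Rat.cast_lt.mpr hd
    exact ne_of_gt (lt_of_le_of_lt hf2 (lt_of_lt_of_le hd' he1))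

/-- The twelve enclosures are pairwise disjoint (milliseconds). [folklore] -/
theorem σcellTrgGEx_separated : σcellTrgGEx.Pairwise fun e f => trgGSep e f = true := by
  decide +kernel

/-- **The twelve listed `TRG` values are pairwise distinct.** [folklore] -/
theorem σcellTrgGEx_nodup_values : (σcellTrgGEx.map trgGTupleVal).Nodup := by
  rw [List.Nodup, List.pairwise_map]
  exact σcellTrgGEx_separated.imp fun h => trgGTupleVal_ne_of_trgGSep h

/-- The list has twelve entries. [folklore] -/
theorem σcellTrgGEx_length : σcellTrgGEx.length = 12 := rfl

/-- **The `TRG` members of the σ-cell (whole table, `Γ` powers included) are exactly 12 distinct real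
numbers.** [folklore] -/
theorem σcell_trg_ncard : {x : ℝ | x ∈ σcell ∧ x ∈ trgFullFamily 17 32}.ncard = 12 := by
  have hiff : ∀ r, r ∈ {x : ℝ | x ∈ σcell ∧ x ∈ trgFullFamily 17 32} ↔
      r ∈ σcellTrgGEx.map trgGTupleVal := fun r => by
    rw [List.mem_map]
    constructor
    · rintro ⟨hr, hm⟩
      obtain ⟨e, he, rfl⟩ := trgFull_listed_of_mem_σcell hr hm
      exact ⟨e, he, rfl⟩
    · rintro ⟨e, he, rfl⟩
      exact ⟨σcellTrgGEx_mem_σcell he, σcellTrgGEx_mem_trgFullFamily he⟩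
  rw [real_ncard_eq_length_of_iff σcellTrgGEx_nodup_values hiff]
  simp [σcellTrgGEx]

/-- The `Γ`-free member `(2/5)·√2·G` is one of the twelve (tuple `(2, 5, 1, 0, 0, 0, 4, 1)`), with the same
value as the `Γ`-free tuple of `σcellTrgEx`. [folklore] -/
theorem trgGTupleVal_two_fifths : trgGTupleVal (2, 5, 1, 0, 0, 0, 4, 1) = (2 / 5 : ℝ) * Real.sqrt 2 * catalan := by
  simp only [trgGTupleVal, trgGVal, trgLVal, uVal, l5Val, zpow_zero, zpow_one, mul_one]
  push_cast
  ring

end ColumnFaceL11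
end Summit.CriticalPhenomena.Ising3D
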